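import Mathlib
import HarnessLib
import Summits.HubbardSuperconductivity.HubbardSuperconductivity.Theses.KLProgramme
import Summits.HubbardSuperconductivity.HubbardSuperconductivity.Theorems.KLProgrammeKLRegimeBetaSplitV14

/-!
# Route `KLProgramme` — crux K3 gen 5, CHILD 1 `KLRegimeBetaSplitV14 := BetaSplitP klPredsV14 klWindowC` (stmt-HubbardSuperconductivity-19919):
# CLOSED by name — `KLRegimeSplit.betaSplitP_klPredsV14 klWindowC` (p488985; = `betaSplitP_of_slotsV9S` p488227 at the V14 bundle p488735)

Cell gate-hubbard-kl, seat hubbard-kl-k3c1-p1 (g4).  The gen-5 split (route rev 17, plan2 g4 for plan g12) re-typed the engine slot's (E2) clause to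
(E2-v9) = (E2-v8) + the crossed particle–hole gains (X) (this seat's E2-DRIVE finding); child 1 closes on it through the entrywise extra family of
`betaSplitP_of_edgeClauses` (k3c1-p2, p474021) — `betaSplitP_of_slotsV9S` (p488227) — and the identity slot maps of `klPredsV14`.  Nothing about
superconductivity is asserted; this is the child's statement BY NAME.
-/

namespace Summit.HubbardSuperconductivity.HubbardSuperconductivity.Theorems

set_option linter.dupNamespace false -- summit = problem name (single-conjunct summit), D-0017

/-- **Child 1 of the gen-5 split of K3, by name**: `KLRegimeBetaSplitV14`. -/
theorem klRegimeBetaSplitV14_proof : Summit.HubbardSuperconductivity.HubbardSuperconductivity.Theses.KLProgramme.KLRegimeBetaSplitV14 :=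
  KLRegimeSplit.betaSplitP_klPredsV14 KLRegimeSplit.klWindowC

end Summit.HubbardSuperconductivity.HubbardSuperconductivity.Theorems
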